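import Mathlib
import Summits.Ventures.PercRepro2.Defs
import Summits.Ventures.PercRepro2.Independence
import Summits.Ventures.PercRepro2.Harris
import Summits.Ventures.PercRepro2.Graph
import Summits.Ventures.PercRepro2.Exploration
import Summits.Ventures.PercRepro2.Events
import Summits.Ventures.PercRepro2.FourFunctions
import Summits.Ventures.PercRepro2.Induced
import Summits.Ventures.PercRepro2.Frontier
import Summits.Ventures.PercRepro2.ObsIndependence
import Summits.Ventures.PercRepro2.BHK
import Summits.Ventures.PercRepro2.BHKEvents
import Summits.Ventures.PercRepro2.OrderPreservation
import Summits.Ventures.PercRepro2.OrderPreservationDual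
import Summits.Ventures.PercRepro2.VdBKahn
import Summits.Ventures.PercRepro2.BHKAvoid
import Summits.Ventures.PercRepro2.R2PrimeThreeReduction
import Summits.Ventures.PercRepro2.YBridge
import Summits.Ventures.PercRepro2.Yu1Functionals
import Summits.Ventures.PercRepro2.Yu1Events
import Summits.Ventures.PercRepro2.Yu1
import Summits.Ventures.PercRepro2.YDeltaTools

/-!
# THEOREM MRl (blind cell PercRepro2, lead g7; `proofs/LEAD-PROOFSHAPES.md` ADDENDUM 17 (14)(c))

Light-first exploration of `S = C(a₁)` (`a₁` light, `a₂` heavy, `a₃` a third root) on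
`R = {a₂ ∉ S, a₃ ∉ S}`, functionals `u`, `β` of `Yu1Functionals`.  Write

* `M_R = P(b ∈ C₂, R) − P(b ∈ C₁, R) = E[β; R] − E[1_b; R]` (`≥ 0` by R10d on `R`, `order_on_R`),
* `D = P(PD) = E[u; R]`, `D_l = P(PD, o ∈ C₁) = E[1_o u; R]`,
* `M_R^{oL} = P(o ∈ C₁, b ∈ C₂, R) − P(o ∈ C₁, b ∈ C₁, R) = E[1_o β; R] − E[1_o 1_b; R]`.

**MRl**: `D · M_R^{oL} ≤ M_R · D_l` (`mrl_cleared`), i.e. the light-share of `M_R` is at most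
`g_l = P(o ∈ C₁ | PD)` times `M_R` (`mrl_theorem`, `P(PD) > 0`).

Proof: ONE BHK 1.3 (`bhk_induced`, `s = a₁`, `X = {a₂, a₃}`) with `f = 1_o` (increasing) and
`g = D·(1 − β) + D·1_b + M_R·u` (increasing and nonnegative because `D, M_R ≥ 0`; this is
`D − (φ·D − u·M_R)` with `φ = β − 1_b` the decreasing multiplier of the light cluster).
`E[g; R] = D·P(R) − D·M_R + M_R·D = D·P(R)` exactly, so BHK gives
`E[1_o; R] · D · P(R) ≤ E[1_o g; R] · P(R)`; the `D · E[1_o; R]` terms cancel and what is left is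
`(M_R · D_l − D · M_R^{oL}) · P(R) ≥ 0`.  `P(R) = 0` is handled separately.
-/

namespace Summit.Ventures.PercRepro2

open UnionCluster Yu1

section MRl

variable {V : Type*} {E : Type*} [Fintype E] [DecidableEq E] [Fintype V] [DecidableEq V]
  {R : Type*} [Field R] [LinearOrder R] [IsStrictOrderedRing R]

omit [Fintype V] [LinearOrder R] [IsStrictOrderedRing R] in
/-- Tower identity: `P(o ∈ C₁, b ∈ C₁, R) = E[1_o(C₁) 1_b(C₁); R]`. -/
lemma tower_ob_light (p : E → R) (ends : E → Sym2 V) (o a₁ a₂ a₃ b : V) :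
    prob p (connEvent ends a₁ o ∩ connEvent ends a₁ b ∩ avoidAll ends a₁ {a₂, a₃}) =
      expect p (fun ω => ind o (cluster ends ω a₁) * ind b (cluster ends ω a₁) *
        (avoidAll ends a₁ {a₂, a₃}).indicator 1 ω) := by
  rw [prob_eq_expect_indicator]
  unfold expect
  refine Finset.sum_congr rfl fun ω _ => ?_
  congr 1
  rw [indicator_inter_one, indicator_inter_one]
  rfl

omit [Fintype V] [LinearOrder R] [IsStrictOrderedRing R] in
/-- Linearity of `expect` for `g = c₁ (1 − β) + c₁ 1_b + c₂ u` against `1_R`. -/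
lemma expect_g (p : E → R) (ends : E → Sym2 V) (a₁ a₂ a₃ b : V) (c₁ c₂ : R) :
    expect p (fun ω => (c₁ * (1 - beta p ends a₂ b (cluster ends ω a₁)) +
        c₁ * ind b (cluster ends ω a₁) + c₂ * u p ends a₂ a₃ (cluster ends ω a₁)) *
        (avoidAll ends a₁ {a₂, a₃}).indicator 1 ω) =
      c₁ * (prob p (avoidAll ends a₁ {a₂, a₃}) -
          expect p (fun ω => beta p ends a₂ b (cluster ends ω a₁) *
            (avoidAll ends a₁ {a₂, a₃}).indicator 1 ω)) +
        c₁ * expect p (fun ω => ind b (cluster ends ω a₁) *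
            (avoidAll ends a₁ {a₂, a₃}).indicator 1 ω) +
        c₂ * expect p (fun ω => u p ends a₂ a₃ (cluster ends ω a₁) *
            (avoidAll ends a₁ {a₂, a₃}).indicator 1 ω) := by
  rw [prob_eq_expect_indicator]
  simp only [expect]
  have h : ∀ x : Config E, weight p x * ((c₁ * (1 - beta p ends a₂ b (cluster ends x a₁)) +
        c₁ * ind b (cluster ends x a₁) + c₂ * u p ends a₂ a₃ (cluster ends x a₁)) *
        (avoidAll ends a₁ {a₂, a₃}).indicator 1 x) =
      c₁ * (weight p x * (avoidAll ends a₁ {a₂, a₃}).indicator 1 x) -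
        c₁ * (weight p x * (beta p ends a₂ b (cluster ends x a₁) *
          (avoidAll ends a₁ {a₂, a₃}).indicator 1 x)) +
        c₁ * (weight p x * (ind b (cluster ends x a₁) *
          (avoidAll ends a₁ {a₂, a₃}).indicator 1 x)) +
        c₂ * (weight p x * (u p ends a₂ a₃ (cluster ends x a₁) *
          (avoidAll ends a₁ {a₂, a₃}).indicator 1 x)) :=
    fun x => by ring
  simp only [h, Finset.sum_add_distrib, Finset.sum_sub_distrib, ← Finset.mul_sum]
  ring

omit [Fintype V] [LinearOrder R] [IsStrictOrderedRing R] in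
/-- Linearity of `expect` for `1_o · g` against `1_R`. -/
lemma expect_og (p : E → R) (ends : E → Sym2 V) (o a₁ a₂ a₃ b : V) (c₁ c₂ : R) :
    expect p (fun ω => ind o (cluster ends ω a₁) *
        (c₁ * (1 - beta p ends a₂ b (cluster ends ω a₁)) +
        c₁ * ind b (cluster ends ω a₁) + c₂ * u p ends a₂ a₃ (cluster ends ω a₁)) *
        (avoidAll ends a₁ {a₂, a₃}).indicator 1 ω) =
      c₁ * (expect p (fun ω => ind o (cluster ends ω a₁) *
            (avoidAll ends a₁ {a₂, a₃}).indicator 1 ω) -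
          expect p (fun ω => ind o (cluster ends ω a₁) * beta p ends a₂ b (cluster ends ω a₁) *
            (avoidAll ends a₁ {a₂, a₃}).indicator 1 ω)) +
        c₁ * expect p (fun ω => ind o (cluster ends ω a₁) * ind b (cluster ends ω a₁) *
            (avoidAll ends a₁ {a₂, a₃}).indicator 1 ω) +
        c₂ * expect p (fun ω => ind o (cluster ends ω a₁) * u p ends a₂ a₃ (cluster ends ω a₁) *
            (avoidAll ends a₁ {a₂, a₃}).indicator 1 ω) := by
  simp only [expect]
  have h : ∀ x : Config E, weight p x * (ind o (cluster ends x a₁) *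
        (c₁ * (1 - beta p ends a₂ b (cluster ends x a₁)) +
        c₁ * ind b (cluster ends x a₁) + c₂ * u p ends a₂ a₃ (cluster ends x a₁)) *
        (avoidAll ends a₁ {a₂, a₃}).indicator 1 x) =
      c₁ * (weight p x * (ind o (cluster ends x a₁) * (avoidAll ends a₁ {a₂, a₃}).indicator 1 x)) -
        c₁ * (weight p x * (ind o (cluster ends x a₁) * beta p ends a₂ b (cluster ends x a₁) *
          (avoidAll ends a₁ {a₂, a₃}).indicator 1 x)) +
        c₁ * (weight p x * (ind o (cluster ends x a₁) * ind b (cluster ends x a₁) *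
          (avoidAll ends a₁ {a₂, a₃}).indicator 1 x)) +
        c₂ * (weight p x * (ind o (cluster ends x a₁) * u p ends a₂ a₃ (cluster ends x a₁) *
          (avoidAll ends a₁ {a₂, a₃}).indicator 1 x)) :=
    fun x => by ring
  simp only [h, Finset.sum_add_distrib, Finset.sum_sub_distrib, ← Finset.mul_sum]
  ring

/-- **The one BHK step of MRl**: BHK 1.3 with `f = 1_o` and `g = c₁ (1 − β) + c₁ 1_b + c₂ u`
(`c₁, c₂ ≥ 0`; both increasing and nonnegative), cleared:
`E[1_o; R] · E[g; R] ≤ E[1_o g; R] · P(R)`. -/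
lemma bhk_mrl (p : E → R) (hp : IsProbVec p) (ends : E → Sym2 V) (o a₁ a₂ a₃ b : V)
    {c₁ c₂ : R} (h₁ : 0 ≤ c₁) (h₂ : 0 ≤ c₂) :
    expect p (fun ω => ind o (cluster ends ω a₁) * (avoidAll ends a₁ {a₂, a₃}).indicator 1 ω) *
      expect p (fun ω => (c₁ * (1 - beta p ends a₂ b (cluster ends ω a₁)) +
        c₁ * ind b (cluster ends ω a₁) + c₂ * u p ends a₂ a₃ (cluster ends ω a₁)) *
        (avoidAll ends a₁ {a₂, a₃}).indicator 1 ω) ≤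
    expect p (fun ω => ind o (cluster ends ω a₁) *
        (c₁ * (1 - beta p ends a₂ b (cluster ends ω a₁)) +
        c₁ * ind b (cluster ends ω a₁) + c₂ * u p ends a₂ a₃ (cluster ends ω a₁)) *
        (avoidAll ends a₁ {a₂, a₃}).indicator 1 ω) *
      prob p (avoidAll ends a₁ {a₂, a₃}) := by
  have hmono : Monotone (fun W : Set V => c₁ * (1 - beta p ends a₂ b W) + c₁ * ind b W +
      c₂ * u p ends a₂ a₃ W) := by
    intro W W' hW
    have hβ := beta_anti p hp ends a₂ b hW
    have hb : (ind b W : R) ≤ ind b W' := ind_mono b hW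
    have hu := u_mono p hp ends a₂ a₃ hW
    simp only
    nlinarith [mul_le_mul_of_nonneg_left hβ h₁, mul_le_mul_of_nonneg_left hb h₁,
      mul_le_mul_of_nonneg_left hu h₂]
  have hnn : ∀ W : Set V, 0 ≤ c₁ * (1 - beta p ends a₂ b W) + c₁ * ind b W +
      c₂ * u p ends a₂ a₃ W := fun W =>
    add_nonneg (add_nonneg (mul_nonneg h₁ (sub_nonneg.2 (beta_le_one p hp ends a₂ b W)))
      (mul_nonneg h₁ (ind_nonneg b W))) (mul_nonneg h₂ (u_nonneg p hp ends a₂ a₃ W))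
  have h := bhk_induced p hp ends a₁ (F₁ := (ind o : Set V → R))
    (F₂ := fun W => c₁ * (1 - beta p ends a₂ b W) + c₁ * ind b W + c₂ * u p ends a₂ a₃ W)
    (ind_mono o) hmono (ind_nonneg o) hnn
    Finset.univ {a₂, a₃} {a₂, a₃} (Finset.subset_univ _) (Finset.subset_univ _)
  simpa only [REvent_univ, Finset.inter_self, Finset.union_self, expect_clusterObs_univ,
    Pi.mul_apply] using h

/-- **THEOREM MRl**, cleared form: `D · M_R^{oL} ≤ M_R · D_l`, i.e.
`P(PD) · (P(o ∈ C₁, b ∈ C₂, R) − P(o ∈ C₁, b ∈ C₁, R)) ≤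
  (P(b ∈ C₂, R) − P(b ∈ C₁, R)) · P(PD, o ∈ C₁)`
under the labelling `P(b ↔ a₁) ≤ P(b ↔ a₂)` (the only place it enters: `M_R ≥ 0`). -/
theorem mrl_cleared (p : E → R) (hp : IsProbVec p) (ends : E → Sym2 V) {o a₁ a₂ a₃ b : V}
    (hord : prob p (connEvent ends a₁ b) ≤ prob p (connEvent ends a₂ b)) :
    prob p (PDEvent ends a₁ a₂ a₃) *
        (prob p (connEvent ends a₁ o ∩ connEvent ends a₂ b ∩ avoidAll ends a₁ {a₂, a₃}) -
          prob p (connEvent ends a₁ o ∩ connEvent ends a₁ b ∩ avoidAll ends a₁ {a₂, a₃})) ≤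
      (prob p (connEvent ends a₂ b ∩ avoidAll ends a₁ {a₂, a₃}) -
          prob p (connEvent ends a₁ b ∩ avoidAll ends a₁ {a₂, a₃})) *
        prob p (PDEvent ends a₁ a₂ a₃ ∩ connEvent ends a₁ o) := by
  have s4 := order_on_R p hp ends (a₃ := a₃) hord
  have hD0 : 0 ≤ prob p (PDEvent ends a₁ a₂ a₃) := prob_nonneg hp _
  have hM0 : 0 ≤ prob p (connEvent ends a₂ b ∩ avoidAll ends a₁ {a₂, a₃}) -
      prob p (connEvent ends a₁ b ∩ avoidAll ends a₁ {a₂, a₃}) := sub_nonneg.2 s4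
  have h := bhk_mrl p hp ends o a₁ a₂ a₃ b hD0 hM0
  rw [expect_g, expect_og] at h
  -- everything in tower form
  rw [tower_PD, tower_N, tower_b] at h
  rw [tower_PD, reg_tower_ob, tower_ob_light, tower_N, tower_b, tower_PDo]
  have hPR : 0 ≤ prob p (avoidAll ends a₁ {a₂, a₃}) := prob_nonneg hp _
  rcases hPR.lt_or_eq with hpos | hzero
  · refine le_of_mul_le_mul_right ?_ hpos
    nlinarith [h]
  · -- `P(R) = 0`: every expectation against `1_R` vanishes
    have hz : ∀ g : Config E → R,
        expect p (fun ω => g ω * (avoidAll ends a₁ {a₂, a₃}).indicator 1 ω) = 0 :=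
      fun g => expect_mul_indicator_eq_zero_of_null hp hzero.symm g
    simp only [hz, mul_zero, sub_zero, le_refl]

/-- **THEOREM MRl**, ratio form (`P(PD) > 0`): the light share of `M_R` is at most
`g_l · M_R` with `g_l = P(o ∈ C₁ | PD)`. -/
theorem mrl_theorem (p : E → R) (hp : IsProbVec p) (ends : E → Sym2 V) {o a₁ a₂ a₃ b : V}
    (hord : prob p (connEvent ends a₁ b) ≤ prob p (connEvent ends a₂ b))
    (hPD : 0 < prob p (PDEvent ends a₁ a₂ a₃)) :
    prob p (connEvent ends a₁ o ∩ connEvent ends a₂ b ∩ avoidAll ends a₁ {a₂, a₃}) -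
        prob p (connEvent ends a₁ o ∩ connEvent ends a₁ b ∩ avoidAll ends a₁ {a₂, a₃}) ≤
      prob p (PDEvent ends a₁ a₂ a₃ ∩ connEvent ends a₁ o) / prob p (PDEvent ends a₁ a₂ a₃) *
        (prob p (connEvent ends a₂ b ∩ avoidAll ends a₁ {a₂, a₃}) -
          prob p (connEvent ends a₁ b ∩ avoidAll ends a₁ {a₂, a₃})) := by
  have key := mrl_cleared p hp ends (o := o) (a₃ := a₃) hord
  rw [div_mul_eq_mul_div, le_div_iff₀ hPD]
  linarith [key]

end MRl

end Summit.Ventures.PercRepro2
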